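import Summits.CriticalPhenomena.PercolationContinuityZ3.Theorems.Transplant.SkelNeg1ChoiceL
import Summits.CriticalPhenomena.PercolationContinuityZ3.Theorems.Transplant.SkelNegBChoiceAllTA
import Summits.CriticalPhenomena.PercolationContinuityZ3.Theorems.Transplant.SkelRootChainW
import HarnessLib

/-!
# N1 (the `{±1}` node), (R) column under (ζ′) + the L closure: GLUE — `RootHoldsNOWFnL NegB.LfA (negChoiceAllOTA …)` from the per-direction root
# residues at `AtQO` GIVEN the flat root table (A-twin of `SkelNeg1RootGlueT`, p3-g10)

builds on p205010 (kernel theorem, internal audit signed; external expert review pending) — nothing here uses it; NOTHING is claimed about the open node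
`SamePDropOfSkeletonNeg₁`.  The budgeted root obligation of the L closure (`SkelNeg1ChoiceL`) hands the discharger `FlatL NegB.LfA κ`; this file threads
it to the per-direction residues (`SkelPhiRootNegBXTA` / `…BYTA` take `hflat`), exactly as the record's glue threads nothing.
Lane `prim-bschramm`, seat `prim-bschramm-p3` (gen 11; design owner + (R) owner); helper file (`--supports stmt-CriticalPhenomena-4575 --as helper`).
* `rootHoldsNOWFnL_negChoiceAllOTA_of` — all directions at once; `rootHoldsNOWFnL_negChoiceAllOTA_of_xy` — x-family / y′-family separated.
[cite: KozmaNitzan2024, §4 p. 28 ((32) at the root)] [folklore]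
-/

noncomputable section

open scoped Classical

namespace Summit.CriticalPhenomena.PercolationContinuityZ3.Theorems.Transplant

namespace PlanarSkeletonNeg

open SkelConc (Consts)
open Skelφ.StepI (OutO)
open Literature.Probability.Percolation

/-- **`RootHoldsNOWFnL NegB.LfA (negChoiceAllOTA …)` from the per-direction root residues at `AtQO`, given the flat root table.** [folklore] -/
theorem rootHoldsNOWFnL_negChoiceAllOTA_of (gv fv : Neg.FSlot) (Pv : NegB.PSlot) (Sv : NegB.SSlot)
    (h : ∀ (κ : Consts) {V : Type} [DecidableEq V] [Countable V] (G : SimpleGraph V) [G.LocallyFinite] (Φ : PlanarSkeletonNeg G) (t : V) (p : unitInterval)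
      (hC : Φ.CylSubcritical p) (O : OutO V) (q : unitInterval), (NegB.choiceAtOTA κ Φ t p gv fv Sv hC Pv).AtQO O q → Φ.types = {t} → 0 < (p : ℝ) → (p : ℝ) < 1 →
      FlatL NegB.LfA κ → ∀ du : MDir, Skel.RootOblTWAt G ((NegB.choiceAtOTA κ Φ t p gv fv Sv hC Pv).scheme O q) Φ.Δ κ.δr du) :
    RootHoldsNOWFnL NegB.LfA (negChoiceAllOTA gv fv Pv Sv) := by
  intro κ V _ _ G _ Φ hg t ht h1 p hp0 hp1 hC hflat O q hAt
  rw [negChoiceAllOTA_eq] at hAt ⊢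
  exact Skel.rootOblTW_iff.2 fun du => h κ G Φ t p hC O q hAt h1 hp0 hp1 hflat du

/-- The same with the two direction families separated (`du.1 = 0`: x-family, `du.1 = 1`: y′-family). [folklore] -/
theorem rootHoldsNOWFnL_negChoiceAllOTA_of_xy (gv fv : Neg.FSlot) (Pv : NegB.PSlot) (Sv : NegB.SSlot)
    (hx : ∀ (κ : Consts) {V : Type} [DecidableEq V] [Countable V] (G : SimpleGraph V) [G.LocallyFinite] (Φ : PlanarSkeletonNeg G) (t : V) (p : unitInterval)
      (hC : Φ.CylSubcritical p) (O : OutO V) (q : unitInterval), (NegB.choiceAtOTA κ Φ t p gv fv Sv hC Pv).AtQO O q → Φ.types = {t} → 0 < (p : ℝ) → (p : ℝ) < 1 →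
      FlatL NegB.LfA κ → ∀ du : MDir, du.1 = 0 → Skel.RootOblTWAt G ((NegB.choiceAtOTA κ Φ t p gv fv Sv hC Pv).scheme O q) Φ.Δ κ.δr du)
    (hy : ∀ (κ : Consts) {V : Type} [DecidableEq V] [Countable V] (G : SimpleGraph V) [G.LocallyFinite] (Φ : PlanarSkeletonNeg G) (t : V) (p : unitInterval)
      (hC : Φ.CylSubcritical p) (O : OutO V) (q : unitInterval), (NegB.choiceAtOTA κ Φ t p gv fv Sv hC Pv).AtQO O q → Φ.types = {t} → 0 < (p : ℝ) → (p : ℝ) < 1 →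
      FlatL NegB.LfA κ → ∀ du : MDir, du.1 = 1 → Skel.RootOblTWAt G ((NegB.choiceAtOTA κ Φ t p gv fv Sv hC Pv).scheme O q) Φ.Δ κ.δr du) :
    RootHoldsNOWFnL NegB.LfA (negChoiceAllOTA gv fv Pv Sv) := by
  refine rootHoldsNOWFnL_negChoiceAllOTA_of gv fv Pv Sv fun κ V _ _ G _ Φ t p hC O q hAt h1 hp0 hp1 hflat du => ?_
  have hd : du.1 = 0 ∨ du.1 = 1 := by rcases du with ⟨i, b⟩; fin_cases i <;> simp
  rcases hd with hd | hd
  · exact hx κ G Φ t p hC O q hAt h1 hp0 hp1 hflat du hd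
  · exact hy κ G Φ t p hC O q hAt h1 hp0 hp1 hflat du hd

end PlanarSkeletonNeg

end Summit.CriticalPhenomena.PercolationContinuityZ3.Theorems.Transplant

end
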